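import Mathlib
import HarnessLib
import HarnessLib.Audit
import Summits.HodgeConjecture.HodgeConjecture.Statement
import Literature.AlgebraicGeometry.HodgeTheory.ComplexGysin
import Literature.AlgebraicGeometry.HodgeTheory.HodgeFiltration
import Literature.AlgebraicGeometry.HodgeTheory.LefschetzOneOne

/-!
Route: NikulinTwinSimilitude

CLOSED (retired) 2026-08-15T13:48:16Z by operator:999:1257524 — reason: not-a-thesis: assembly does not conclude the sub-problem Statement — note: D-0027 §2.1 audit (human 2026-08-15: routes that do not decide the summit are removed): the assembly concludes `SquareHodgeOfSqrtTwo`, not the sub-problem statement; a NEW conforming route may be opened from the same idea (generated `closes : … → _root_.HodgeConjecture`).. The file is kept as the record of this route; refuted decls are indexed as negative knowledge (`ledger negatives`).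

THESIS X (card nikulin-serre-bundle-k3-similitudes; "it suffices to show X"): Sim_2(K3) — for every
pair of smooth projective K3 surfaces S, S' over C, every rational Hodge similitude of multiplier 2,
psi : H^2(S',Q) -> H^2(S,Q) with (psi x . psi y) = 2 (x . y), is algebraic (its class in H^4(S x S',
Q) is the Kuenneth (2,2)-part of an algebraic cycle; equivalently psi = [Z]_* on H^2). By Buskin's
theorem and composition of correspondences X is equivalent to: the class graph(Psi) is algebraic on
S x S' for every twin pair (S,S') in the Hecke correspondence B of ONE completed Nikulin
2-similitude Psi = g^* + (N_j -> r_j) (eight pairwise orthogonal roots r_j of E_8(-2)); at the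
Nikulin anchor (X, Y') it is algebraic (Varesco2023 Sec. 2), and the route carries 2 graph(Psi)
along B as c_2 of a polystable hyperholomorphic Serre-type sheaf on X x Y' (cruxes
NikulinSerreCarrier, TwinTwistorTransport).
ASSEMBLY: X -> (Buskin: Hodge isometries of T algebraic) -> (twin exists: period surjectivity) ->
Lefschetz (1,1) -> HC_4(S x S) for every projective K3 S with End_Hdg(T(S)_Q) = Q(sqrt 2)
[factorisation phi := (1/2) e o psi is a T-isometry, e = phi o psi^t; Varesco2023 Thm 2.1 with the
TWIN in place of the Nikulin quotient] — the maximal 8-dimensional RM families of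
VanGeemenSchuett2023 included; with crux HodgeSimilitudeAlgebraic (all multipliers) the same for
multiquadratic RM and: every rational Hodge similitude between projective K3 surfaces is algebraic.
LEAN (elaborates, folder Sketch.lean rc 0; the tree has no K3 notion, so typed statements use the
K3-LIKE PROXY `IsSmoothProjective 2 S ∧ b_1 = 0 ∧ b_2 = 22 ∧ h^{2,0} = 1` and say so; 'multiplier 2'
via integral generators p, p' of H^4 and the real cup product; 'algebraic' via the real Gysin/cup
correspondence action, for all orientation families mu with Poincare duality). One line
(abbreviated; full term = item TwinSimilitudeAlgebraic): ∀ μ, μ.HasPoincareDuality → ∀ S S' (hS hS'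
: IsSmoothProjective 2 _), K3like S → K3like S' → ∀ p p' (integral generators of H^4), ∀ ψ :
complexBetti S' 2 →ₗ[ℂ] complexBetti S 2, (rational) → (Hodge-type preserving) → (∀ x y a, x ∪ y = a
• p' → ψ x ∪ ψ y = (2a) • p) → ∃ γ ∈ algebraicClasses (S ⊗ S') 2, ∀ x, ψ x = complexGysin μ _ hS
(fst S S') _ (snd^* x ∪ γ).

Rationale: WHY THIS LINE. Buskin2019 (reproved Huybrechts2019) makes every rational Hodge ISOMETRY between
transcendental lattices of projective K3 surfaces algebraic by carrying a stable sheaf on S x M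
along twistor lines as a hyperholomorphic bundle (Verbitsky1996Hyperholomorphic); Markman2024 does
the same for K3^[n] with twisted sheaves. Varesco2023 Thm 2.1 (READ, p.8) shows that a symplectic
automorphism of order p supplies an ALGEBRAIC Hodge similarity phi = beta_* pi^* of multiplier p,
and that for Q(sqrt p) in End_Hdg(T) the RM class is phi o (Hodge isometry), hence algebraic — but
only on the Nikulin/sigma_p locus (T in U^3_Q + E_8(-2)_Q, Prop 2.5; 4-dim families, Thm 2.9), while
real multiplication lives on 8-dim families (VanGeemenSchuett2023, VanGeemen2008RM) where no cycle
is known. The card's move: leave the Nikulin locus by completing g^* to an INTEGRAL 2-similitude Psi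
of the whole K3 lattice (roots of E_8(-2)), so that every marked K3 S has a twin S' with Psi Hodge,
and transport 2 graph(Psi) — SU(2)-invariant for Psi-matched product hyperkaehler structures, unlike
the naive graph — as c_2 of a polystable Serre-type sheaf along twistor chains in the twin locus.
Imported areas: hyperkaehler/twistor geometry and Yang-Mills (hyperholomorphic = stable with
invariant c_1,c_2), lattice theory of Nikulin involutions (VanGeemenSarti2007, Morrison1984), Hodge
theory of K3 (Zarhin1983). Catalogue: a geometric lift/transport mechanism (no spectral,
probabilistic or model-theoretic import; certified computation only for the lattice item).
RANKED CRUXES. r2 HodgeIsometryAlgebraic = Buskin's theorem, typed (FIRST because it is the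
load-bearing named fact not yet in Literature; cite item filed). r3 NikulinSerreCarrier (informal;
the research heart: a slope-polystable reflexive sheaf on X x Y' with c_1 = 0, c_2^{mixed} = 2m
graph Psi). r4 TwinTwistorTransport (informal: Verbitsky for products with Psi-matched Kaehler
classes, stability persistence along generic twistor paths inside B, GAGA endpoint). r5
HodgeSimilitudeAlgebraic (typed: all multipliers; anchors of order 3,5,7 and Kummer l-isogenies).
Target r0 TwinSimilitudeAlgebraic (typed X). Support: TwinExists,
RealMultiplicationSqrtTwoAlgebraic, SquareHodgeOfSqrtTwo (the summit fragment = Assembly codomain),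
TwinFactorisation (linear algebra, provable now), EEightTwoSimilitude (lattice, decidable now).
KILL CRITERIA. (i) F (rank-2 Serre bundle along the 2:1 graph) and every elementary modification
with the required Chern classes is omega+omega'-unstable with destabilising subsheaf of
non-invariant c_1 for all matched Kaehler pairs near the anchor, AND the BKR/twisted fallbacks fail
=> close r3 and the route (the no-go for effective carriers, card N0', already excludes cycles).
(ii) A Voisin-type theorem 'on a very general twin pair every coherent (twisted) sheaf on S x S' has
c_2 with vanishing graph(Psi)-component' kills the line outright. (iii) A refutation of
TwinSimilitudeAlgebraic refutes HC. (iv) If r2 turns out mis-typed (sign/normalisation of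
complexGysin), restate, do not close.
DELIBERATELY NOT DECOMPOSED. The glue NikulinSerreCarrier -> TwinTwistorTransport -> GAGA endpoint
-> X stays informal until IsK3Surface / Kaehler class / slope-polystability / analytic Chern classes
exist in Literature (definition requests filed); the choice of Nikulin family (degree 2d, absence of
(-2)-walls), the rank of the carrier, twisted vs untwisted transport, and the other primes (r5) are
below crux level. Kuenneth and correspondence-composition lemmas for the real cohomology carriers
are prover lemmas under --supports Assembly.
NOVELTY / BARRIERS: see the dedicated header sections (searched: Varesco2023 READ pp.3,8-11, grep
twistor|hyperholomorphic = 0 hits; card audit by refuter-novelty-audit-7 READ Varesco; lit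
search/galaxy unavailable 2026-08-15, noted in NOTES).

Novelty: Nearest prior art (searched and READ): Varesco2023 = arXiv:2304.02519 =
doi:10.1007/s00209-023-03390-8, Sec. 2 p.8 (anchor: phi = beta_* pi^* : T(Y) -> T(X) algebraic Hodge
similarity of multiplier p from a symplectic sigma_p) and Thm 2.1 (psi o phi^{-1} isometry =>
algebraic by Buskin => sqrt p algebraic) = the card's factorisation verbatim, confined to K3s
Hodge-isometric to a Nikulin K3 (Prop 2.5: T in U^3_Q + E_8(-2)_Q, dim T <= 13; Thm 2.9: 4-dim
families; Rem 2.10); Thm 0.3/Sec. 3: all Hodge similarities algebraic CONDITIONALLY on Kuga-Satake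
HC. Engine: Buskin2019 = doi:10.1515/crelle-2017-0027 (twistor paths + hyperholomorphic sheaves on S
x M, ISOMETRIES only), Huybrechts2019 (derived reproof), Markman2024 = doi:10.1112/S0010437X24007048
(twisted hyperholomorphic sheaves, isometries of K3^[n] type), Verbitsky1996Hyperholomorphic. State
of RM: VanGeemen2008RM, VanGeemenSchuett2023 = arXiv:2310.05196 (maximal RM families; inducing cycle
unknown), Schlickewei/Varesco Picard-16 Kuga-Satake cases. DELTA (graded new-combination by
refuter-novelty-audit-HodgeConjecture-HodgeConjecture-7-0, 2026-08-15): leaving the Nikulin locus —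
(a) completing g^* to an INTEGRAL 2-similitude Psi of the K3 lattice by eight orthogonal roots of
E_8(-2) and the twin Hecke correspondence B (every K3 has a twin), (b) transporting 2 graph(Psi)
(SU(2)-invariant, unlike the naive graph) as c_2 of a polystable hyperholomorphic Serre-type sheaf
on X x Y' along twistor chains inside B = Buskin/Markman  [refs: 10.1007/s00209-023-03390-8, 10.1515/crelle-2017-0027, 10.1112/S0010437X24007048, 2304.02519, 2310.05196, doi:10.1007/s00209-023-03390-8, doi:10.1515/crelle-2017-0027, doi:10.1112/S0010437X24007048, Varesco2023, Buskin2019, Huybrechts2019, Markman2024, VanGeemenSchuett2023]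

Barriers (technique_class: hyperholomorphic-sheaves, chern-classes-of-coherent-sheaves): technique_class: hyperholomorphic-sheaves, chern-classes-of-coherent-sheaves
- Literature.Barriers.HodgeConjecture.Voisin2002_weilTorus_hodgeClassWithoutSubvarieties: APPLIES to
the carrier class (Chern classes of coherent sheaves do not span Hodge classes on general compact
Kaehler manifolds). Evasion: the transport passes through NON-projective twin pairs only as a road —
there the hyperholomorphic sheaf carries 2 graph(Psi) analytically and nothing is claimed;
algebraicity is extracted only at PROJECTIVE endpoints (GAGA/Chow: c_2 of a coherent analytic sheaf
on a projective manifold is algebraic) and Buskin's theorem (projective K3s) closes the loop. On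
Voisin's Weil torus there is no K3-type period domain, no twistor connectivity to an algebraic
anchor, and no claim. The honest residual bet: no Voisin-type vanishing 'every (twisted) sheaf on a
very general twin pair has c_2 with zero graph(Psi)-component' holds — I_Delta on S x S already has
c_2 = [Delta], and Buskin's isometric case is a theorem.
- Literature.Barriers.HodgeConjecture.Zucker1977_kaehlerTorus_noAnalyticCycles: APPLIES to any
CYCLE-valued transport; evaded the same way, and positively used: the card's non-effectivity lemma
(no effective 2-cycle on a very general S x S' has graph-type class) is a Zucker-type statement for
K3 x K3 showing that bundles of rank >= 2, not subvarieties, must be the carriers (as in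
Buskin2019).
- Literature.Barriers.HodgeConjecture.AtiyahHirzebruch1962_torsionClass_notAlgebraic an

History (route lifecycle, newest last):
- 2026-08-15T13:48:17Z · CLOSED retired — not-a-thesis: assembly does not conclude the sub-problem Statement (operator:999:1257524)

sub-problem: HodgeConjecture · status: closed(retired) · opened planner-plancard-HodgeConjecture-HodgeConject-3ef2a0e7-0 2026-08-15T11:07:37Z · rev 2 · ledger route-HodgeConjecture-NikulinTwinSimilitude
GENERATED by the gate from the ledger (D-0016/17). Provers cite these decls: `theorem foo : Summit.HodgeConjecture.HodgeConjecture.Theses.NikulinTwinSimilitude.<Decl> := …` in Summits/HodgeConjecture/HodgeConjecture/Theorems/<Name>.lean.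
-/

namespace Summit.HodgeConjecture.HodgeConjecture.Theses.NikulinTwinSimilitude

open scoped BigOperators Topology Manifold Classical MeasureTheory ProbabilityTheory Matrix InnerProductSpace ComplexConjugate ContinuousMap
open Filter Set Function TopologicalSpace MeasureTheory

attribute [summit_statement] _root_.HodgeConjecture

/-- item stmt-HodgeConjecture-2748 · target · rank 0 · closed · moot by None · by planner
why it might fail: Open sub-case of HC: VanGeemenSchuett2023 (cycle inducing RM unknown on maximal families); Varesco2023 Thm 2.1/Prop 2.5 cover only T in U^3_Q+E_8(-2)_Q (dim T <= 13). A non-algebraic Hodge 2-similitude between K3s would refute HC; the proxy typing over-includes kappa=1 homotopy-K3 surfaces.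
sources: Varesco2023, Buskin2019, Huybrechts2019, VanGeemenSarti2007, VanGeemenSchuett2023, arXiv:2304.02519
[target] THESIS X = Sim_2(K3): for projective K3 surfaces S, S', every rational Hodge similitude of
multiplier 2, psi : H^2(S',Q) -> H^2(S,Q) ((psi x . psi y) = 2 (x . y)), is algebraic: its class in
H^4(S x S', Q) is the Kuenneth (2,2)-component of an algebraic cycle, i.e. psi = [Z]_* on H^2.
Equivalent (Buskin2019/Huybrechts2019 + composition of correspondences) to the card's thesis
'graph(Psi) is algebraic on S x S' for every twin pair (S,S') in the Hecke correspondence B of the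
completed Nikulin 2-similitude Psi = g^* + (N_j -> r_j)' (VanGeemenSarti2007 Sec. 1-2 for g^*,
E_8(-2) and the even eight). At the Nikulin anchor (X, Y') graph(Psi) = graph(g^*) - (1/2) sum_j N_j
(x) r_j IS algebraic (Varesco2023 Sec. 2 p.8: phi = beta_* pi^* is an algebraic similarity of
multiplier p); the claim is that it stays algebraic along B, via NikulinSerreCarrier +
TwinTwistorTransport + GAGA endpoint (glue below X, informal until the notions land). LEAN: typed
over the K3-LIKE PROXY 'smooth projective surface with b_1 = 0, b_2 = 22, h^{2,0} = 1' on both sides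
(the tree has no K3 notion — no canonical sheaf; definition request IsK3Surface filed). The proxy
also contains simply-connected Kodaira- -/
@[route_item "route-HodgeConjecture-NikulinTwinSimilitude"]
def TwinSimilitudeAlgebraic : Prop :=
  ∀ (μ : Literature.AlgebraicGeometry.HodgeTheory.OrientationFamily), μ.HasPoincareDuality → ∀ (S S' : Literature.AlgebraicGeometry.Motives.SchemeOver ℂ) (hS : Literature.AlgebraicGeometry.Motives.IsSmoothProjective 2 S) (hS' : Literature.AlgebraicGeometry.Motives.IsSmoothProjective 2 S'), (Subsingleton (Literature.AlgebraicGeometry.HodgeTheory.complexBetti S 1) ∧ Module.finrank ℂ (Literature.AlgebraicGeometry.HodgeTheory.complexBetti S (2 * 1)) = 22 ∧ Module.finrank ℂ (Submodule.span ℂ {c : Literature.AlgebraicGeometry.HodgeTheory.complexBetti S (2 * 1) | Literature.AlgebraicGeometry.HodgeTheory.IsOfHodgeType 2 S (2 * 1) 2 0 c}) = 1) → (Subsingleton (Literature.AlgebraicGeometry.HodgeTheory.complexBetti S' 1) ∧ Module.finrank ℂ (Literature.AlgebraicGeometry.HodgeTheory.complexBetti S' (2 * 1)) = 22 ∧ Module.finrank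 ℂ (Submodule.span ℂ {c : Literature.AlgebraicGeometry.HodgeTheory.complexBetti S' (2 * 1) | Literature.AlgebraicGeometry.HodgeTheory.IsOfHodgeType 2 S' (2 * 1) 2 0 c}) = 1) → ∀ (p : Literature.AlgebraicGeometry.HodgeTheory.complexBetti S (2 * 2)) (p' : Literature.AlgebraicGeometry.HodgeTheory.complexBetti S' (2 * 2)), (Literature.AlgebraicGeometry.HodgeTheory.IsIntegralClass p ∧ (∀ q : Literature.AlgebraicGeometry.HodgeTheory.complexBetti S (2 * 2), Literature.AlgebraicGeometry.HodgeTheory.IsIntegralClass q → ∃ n : ℤ, q = n • p)) → (Literature.AlgebraicGeometry.HodgeTheory.IsIntegralClass p' ∧ (∀ q : Literature.AlgebraicGeometry.HodgeTheory.complexBetti S' (2 * 2), Literature.AlgebraicGeometry.HodgeTheory.IsIntegralClass q → ∃ n : ℤ, q = n • p')) → ∀ (ψ : Literature.AlgebraicGeometry.HodgeTheory.complexBetti S' (2 * 1) →ₗ[ℂ] Literature.AlgebraicGeometry.HodgeTheory.complexBetti S (2 * 1)), (∀ x, Literature.AlgebraicGeometry.HodgeTheory.IsRationalClass x → Literature.AlgebraicGeometry.HodgeTheory.IsRationalClass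 (ψ x)) → (∀ (i j : ℕ) x, Literature.AlgebraicGeometry.HodgeTheory.IsOfHodgeType 2 S' (2 * 1) i j x → Literature.AlgebraicGeometry.HodgeTheory.IsOfHodgeType 2 S (2 * 1) i j (ψ x)) → (∀ (x y : Literature.AlgebraicGeometry.HodgeTheory.complexBetti S' (2 * 1)) (a : ℂ), Literature.AlgebraicTopology.SingularHomology.cupProduct (rfl : 2 * 1 + 2 * 1 = 2 * 2) x y = a • p' → Literature.AlgebraicTopology.SingularHomology.cupProduct (rfl : 2 * 1 + 2 * 1 = 2 * 2) (ψ x) (ψ y) = ((2 : ℂ) * a) • p) → ∃ γ ∈ Literature.AlgebraicGeometry.HodgeTheory.algebraicClasses (CategoryTheory.MonoidalCategoryStruct.tensorObj S S') 2, ∀ x : Literature.AlgebraicGeometry.HodgeTheory.complexBetti S' (2 * 1), ψ x = Literature.AlgebraicGeometry.HodgeTheory.complexGysin μ (Literature.AlgebraicGeometry.Motives.IsSmoothProjective.tensor_holds hS hS') hS (CategoryTheory.SemiCartesianMonoidalCategory.fst S S') (rfl : 2 * 1 + 2 * 2 + 2 * 2 = 2 * 1 + 2 * (2 + 2)) (Literature.AlgebraicTopology.SingularHomology.cupProduct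 (rfl : 2 * 1 + 2 * 2 = 2 * 1 + 2 * 2) (Literature.AlgebraicGeometry.HodgeTheory.complexBetti.map (CategoryTheory.SemiCartesianMonoidalCategory.snd S S') (2 * 1) x) γ)

/-- item stmt-HodgeConjecture-2749 · crux · rank 2 · closed · moot by None · by planner
why it might fail: Theorem for projective K3 pairs (Buskin2019 Thm 1.1, Huybrechts2019 Thm 0.2), but typed over the K3-like proxy it also covers simply-connected kappa=1 elliptic surfaces with p_g=1, where it is open; sign/normalisation conventions of the in-tree complexGysin action may force a restatement.
sources: Buskin2019, Huybrechts2019, Varesco2023, Markman2024, doi:10.1515/crelle-2017-0027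
[crux, ranked FIRST by the plancard rule: the mechanism's load-bearing UNPROVED NAMED FACT] Buskin's
theorem (Buskin2019 Thm 1.1; derived reproof Huybrechts2019 Thm 0.2; quoted Varesco2023 p.3): every
rational Hodge isometry T(S')_Q -> T(S)_Q between transcendental lattices of PROJECTIVE K3 surfaces
is induced by an algebraic class on S x S'. Typed in the 'T-version' used by the Assembly: phi :
H^2(S') -> H^2(S) rational, Hodge, killing NS(S') := algebraicClasses S' 1, mapping T(S') :=
NS(S')^perp into T(S), isometric on T(S') (w.r.t. integral generators p', p of H^4) => phi =
[gamma]_* for an algebraic gamma (the NS'^v (x) NS correction of Buskin's cycle is algebraic by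
Lefschetz (1,1), so this is Buskin + bookkeeping). Used exactly as in Varesco2023 Thm 2.1: phi :=
(1/2) e o psi (e the RM endomorphism, psi the twin 2-similitude) is such a T-isometry. Not in
Literature: to be vendored as a named fact (cite workitem filed:
`Buskin2019_hodgeIsometry_algebraic`), after which this item is re-filed with `(h : Fact) ->` or
closed by it. LEAN: K3-like proxy (b_1 = 0, b_2 = 22, h^{2,0} = 1) on both sides — for the proxy's
non-K3 members the statement is NOT known; restate with IsK3Surface -/
@[route_item "route-HodgeConjecture-NikulinTwinSimilitude"]
def HodgeIsometryAlgebraic : Prop :=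
  ∀ (μ : Literature.AlgebraicGeometry.HodgeTheory.OrientationFamily), μ.HasPoincareDuality → ∀ (S S' : Literature.AlgebraicGeometry.Motives.SchemeOver ℂ) (hS : Literature.AlgebraicGeometry.Motives.IsSmoothProjective 2 S) (hS' : Literature.AlgebraicGeometry.Motives.IsSmoothProjective 2 S'), (Subsingleton (Literature.AlgebraicGeometry.HodgeTheory.complexBetti S 1) ∧ Module.finrank ℂ (Literature.AlgebraicGeometry.HodgeTheory.complexBetti S (2 * 1)) = 22 ∧ Module.finrank ℂ (Submodule.span ℂ {c : Literature.AlgebraicGeometry.HodgeTheory.complexBetti S (2 * 1) | Literature.AlgebraicGeometry.HodgeTheory.IsOfHodgeType 2 S (2 * 1) 2 0 c}) = 1) → (Subsingleton (Literature.AlgebraicGeometry.HodgeTheory.complexBetti S' 1) ∧ Module.finrank ℂ (Literature.AlgebraicGeometry.HodgeTheory.complexBetti S' (2 * 1)) = 22 ∧ Module.finrank ℂ (Submodule.span ℂ {c : Literature.AlgebraicGeometry.HodgeTheory.complexBetti S' (2 * 1) | Literature.AlgebraicGeometry.HodgeTheory.IsOfHodgeType 2 S' (2 * 1) 2 0 c})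 = 1) → ∀ (p : Literature.AlgebraicGeometry.HodgeTheory.complexBetti S (2 * 2)) (p' : Literature.AlgebraicGeometry.HodgeTheory.complexBetti S' (2 * 2)), (Literature.AlgebraicGeometry.HodgeTheory.IsIntegralClass p ∧ (∀ q : Literature.AlgebraicGeometry.HodgeTheory.complexBetti S (2 * 2), Literature.AlgebraicGeometry.HodgeTheory.IsIntegralClass q → ∃ n : ℤ, q = n • p)) → (Literature.AlgebraicGeometry.HodgeTheory.IsIntegralClass p' ∧ (∀ q : Literature.AlgebraicGeometry.HodgeTheory.complexBetti S' (2 * 2), Literature.AlgebraicGeometry.HodgeTheory.IsIntegralClass q → ∃ n : ℤ, q = n • p')) → ∀ (φ : Literature.AlgebraicGeometry.HodgeTheory.complexBetti S' (2 * 1) →ₗ[ℂ] Literature.AlgebraicGeometry.HodgeTheory.complexBetti S (2 * 1)), (∀ x, Literature.AlgebraicGeometry.HodgeTheory.IsRationalClass x → Literature.AlgebraicGeometry.HodgeTheory.IsRationalClass (φ x)) → (∀ (i j : ℕ) x, Literature.AlgebraicGeometry.HodgeTheory.IsOfHodgeType 2 S' (2 * 1) i j x → Literature.AlgebraicGeometry.HodgeTheory.IsOfHodgeType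 2 S (2 * 1) i j (φ x)) → (∀ d' ∈ Literature.AlgebraicGeometry.HodgeTheory.algebraicClasses S' 1, φ d' = 0) → (∀ x : Literature.AlgebraicGeometry.HodgeTheory.complexBetti S' (2 * 1), (∀ d' ∈ Literature.AlgebraicGeometry.HodgeTheory.algebraicClasses S' 1, Literature.AlgebraicTopology.SingularHomology.cupProduct (rfl : 2 * 1 + 2 * 1 = 2 * 2) x d' = 0) → ∀ d ∈ Literature.AlgebraicGeometry.HodgeTheory.algebraicClasses S 1, Literature.AlgebraicTopology.SingularHomology.cupProduct (rfl : 2 * 1 + 2 * 1 = 2 * 2) (φ x) d = 0) → (∀ (x y : Literature.AlgebraicGeometry.HodgeTheory.complexBetti S' (2 * 1)) (a : ℂ), (∀ d' ∈ Literature.AlgebraicGeometry.HodgeTheory.algebraicClasses S' 1, Literature.AlgebraicTopology.SingularHomology.cupProduct (rfl : 2 * 1 + 2 * 1 = 2 * 2) x d' = 0) → (∀ d' ∈ Literature.AlgebraicGeometry.HodgeTheory.algebraicClasses S' 1, Literature.AlgebraicTopology.SingularHomology.cupProduct (rfl : 2 * 1 + 2 * 1 = 2 * 2) y d' = 0) →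 Literature.AlgebraicTopology.SingularHomology.cupProduct (rfl : 2 * 1 + 2 * 1 = 2 * 2) x y = a • p' → Literature.AlgebraicTopology.SingularHomology.cupProduct (rfl : 2 * 1 + 2 * 1 = 2 * 2) (φ x) (φ y) = a • p) → ∃ γ ∈ Literature.AlgebraicGeometry.HodgeTheory.algebraicClasses (CategoryTheory.MonoidalCategoryStruct.tensorObj S S') 2, ∀ x : Literature.AlgebraicGeometry.HodgeTheory.complexBetti S' (2 * 1), φ x = Literature.AlgebraicGeometry.HodgeTheory.complexGysin μ (Literature.AlgebraicGeometry.Motives.IsSmoothProjective.tensor_holds hS hS') hS (CategoryTheory.SemiCartesianMonoidalCategory.fst S S') (rfl : 2 * 1 + 2 * 2 + 2 * 2 = 2 * 1 + 2 * (2 + 2)) (Literature.AlgebraicTopology.SingularHomology.cupProduct (rfl : 2 * 1 + 2 * 2 = 2 * 1 + 2 * 2) (Literature.AlgebraicGeometry.HodgeTheory.complexBetti.map (CategoryTheory.SemiCartesianMonoidalCategory.snd S S') (2 * 1) x) γ)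

-- item stmt-HodgeConjecture-2806 · crux · rank 3 · closed · moot by None · by planner — informal only, no Lean statement yet:
--   [crux] K1 CARRIER AT THE NIKULIN ANCHOR (rank 3; the research heart). Data: X a K3 with Nikulin
--   involution iota, NS(X) ⊇ <2d> ⊕ E_8(-2), X generic in a family chosen so that no (-2)-class
--   obstructs (VanGeemenSarti2007 Prop. 2.2-2.3, 2.7); Y' = minimal resolution of X/iota with nodal
--   curves N_1..N_8 and even eight delta = (1/2) sum N_j in NS(Y'); g : X --> Y' of degree 2, g~ : Bl_8
--   X -> Y'; Psi := g^* on N^perp ⊕ (N_j -> r_j), r_j eight pairwise orthogonal (-4)-vectors of E_8(-2)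
--   ⊂ NS(X) with (1/2) sum r_j in E_8(-2) (EEightTwoSimilitude) — an integral 2-similitude H^2(Y',Z) ->
--   H^2(X,Z). CLAIM:

-- item stmt-HodgeConjecture-2807 · crux · rank 4 · closed · moot by None · by planner — informal only, no Lean statement yet:
--   [crux] K2 TRANSPORT ALONG THE TWIN LOCUS (rank 4). (a) Verbitsky's theorem
--   (Verbitsky1996Hyperholomorphic) for the REDUCIBLE hyperkaehler manifold X x Y' with product metric
--   and the Psi-matched diagonal SU(2): a slope-polystable reflexive sheaf with SU(2)-invariant c_1, c_2
--   is (projectively) hyperholomorphic and extends over the product twistor line {(X_t, Y'_t)}; the twin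
--   of every twistor fibre is the corresponding fibre of the partner line (linear algebra: Psi
--   intertwines the two SO(3)-actions once the phase of sigma' is fixed), so the whole line lies in the
--   twin locus B = {(S,S') : Psi : H^

/-- item stmt-HodgeConjecture-2750 · crux · rank 5 · closed · moot by None · by planner
why it might fail: No symplectic automorphism of prime order p > 7 exists (Nikulin; Huybrechts2016K3 Ch.15): anchors for large p must be Kummer surfaces of l-isogenous abelian surfaces, whose completed similitude may have no SU(2)-invariant completion; carrier stability unverified for all p; proxy caveat as for X.
sources: Varesco2023, Huybrechts2016K3, Buskin2019, Morrison1984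
[crux] K4 of the card, ALL MULTIPLIERS: every rational Hodge similitude of any positive rational
multiplier r between H^2 of projective K3 surfaces is algebraic. Plan: one anchor per prime p —
symplectic automorphisms of order 3, 5, 7 (X -> X/sigma_p resolved, anti-invariant lattices K_p;
Varesco2023 Sec. 2 and p.11: for p = 5, 7 the quotient families carry no RM, but the anchor
similarity beta_* pi^* still exists and is algebraic) and Kummer-type anchors Km(A) --> Km(A') for
l-isogenies of abelian surfaces (all l), each completed to an integral p-similitude of the K3
lattice by roots of K_p and transported as in TwinTwistorTransport; multipliers multiply and squares
are isometries (HodgeIsometryAlgebraic), so prime multipliers suffice. Output: every rational Hodge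
similitude between projective K3 surfaces is algebraic; with the Assembly's bookkeeping, HC(S x S)
for every K3 whose End_Hdg(T(S)_Q) is spanned by square roots of rationals (multiquadratic RM).
Known conditionally: Varesco2023 Thm 0.3 / Sec. 3 (Kuga-Satake HC for both sides => all Hodge
similarities algebraic). LEAN: K3-like proxy both sides; r : Q with 0 < r (impossible multipliers
are vacuous); implies TwinSimilitudeA -/
@[route_item "route-HodgeConjecture-NikulinTwinSimilitude"]
def HodgeSimilitudeAlgebraic : Prop :=
  ∀ (r : ℚ), 0 < r → ∀ (μ : Literature.AlgebraicGeometry.HodgeTheory.OrientationFamily), μ.HasPoincareDuality → ∀ (S S' : Literature.AlgebraicGeometry.Motives.SchemeOver ℂ) (hS : Literature.AlgebraicGeometry.Motives.IsSmoothProjective 2 S) (hS' : Literature.AlgebraicGeometry.Motives.IsSmoothProjective 2 S'), (Subsingleton (Literature.AlgebraicGeometry.HodgeTheory.complexBetti S 1) ∧ Module.finrank ℂ (Literature.AlgebraicGeometry.HodgeTheory.complexBetti S (2 * 1)) = 22 ∧ Module.finrank ℂ (Submodule.span ℂ {c : Literature.AlgebraicGeometry.HodgeTheory.complexBetti S (2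 * 1) | Literature.AlgebraicGeometry.HodgeTheory.IsOfHodgeType 2 S (2 * 1) 2 0 c}) = 1) → (Subsingleton (Literature.AlgebraicGeometry.HodgeTheory.complexBetti S' 1) ∧ Module.finrank ℂ (Literature.AlgebraicGeometry.HodgeTheory.complexBetti S' (2 * 1)) = 22 ∧ Module.finrank ℂ (Submodule.span ℂ {c : Literature.AlgebraicGeometry.HodgeTheory.complexBetti S' (2 * 1) | Literature.AlgebraicGeometry.HodgeTheory.IsOfHodgeType 2 S' (2 * 1) 2 0 c}) = 1) → ∀ (p : Literature.AlgebraicGeometry.HodgeTheory.complexBetti S (2 * 2)) (p' : Literature.AlgebraicGeometry.HodgeTheory.complexBetti S' (2 * 2)), (Literature.AlgebraicGeometry.HodgeTheory.IsIntegralClass p ∧ (∀ q : Literature.AlgebraicGeometry.HodgeTheory.complexBetti S (2 * 2), Literature.AlgebraicGeometry.HodgeTheory.IsIntegralClass q → ∃ n : ℤ, q = n • p)) → (Literature.AlgebraicGeometry.HodgeTheory.IsIntegralClass p' ∧ (∀ q : Literature.AlgebraicGeometry.HodgeTheory.complexBetti S' (2 * 2), Literature.AlgebraicGeometry.HodgeTheory.IsIntegralClass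 q → ∃ n : ℤ, q = n • p')) → ∀ (ψ : Literature.AlgebraicGeometry.HodgeTheory.complexBetti S' (2 * 1) →ₗ[ℂ] Literature.AlgebraicGeometry.HodgeTheory.complexBetti S (2 * 1)), (∀ x, Literature.AlgebraicGeometry.HodgeTheory.IsRationalClass x → Literature.AlgebraicGeometry.HodgeTheory.IsRationalClass (ψ x)) → (∀ (i j : ℕ) x, Literature.AlgebraicGeometry.HodgeTheory.IsOfHodgeType 2 S' (2 * 1) i j x → Literature.AlgebraicGeometry.HodgeTheory.IsOfHodgeType 2 S (2 * 1) i j (ψ x)) → (∀ (x y : Literature.AlgebraicGeometry.HodgeTheory.complexBetti S' (2 * 1)) (a : ℂ), Literature.AlgebraicTopology.SingularHomology.cupProduct (rfl : 2 * 1 + 2 * 1 = 2 * 2) x y = a • p' → Literature.AlgebraicTopology.SingularHomology.cupProduct (rfl : 2 * 1 + 2 * 1 = 2 * 2) (ψ x) (ψ y) = (((r : ℚ) : ℂ) * a) • p) → ∃ γ ∈ Literature.AlgebraicGeometry.HodgeTheory.algebraicClasses (CategoryTheory.MonoidalCategoryStruct.tensorObj S S') 2, ∀ x : Literature.AlgebraicGeometry.HodgeTheory.complexBetti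 S' (2 * 1), ψ x = Literature.AlgebraicGeometry.HodgeTheory.complexGysin μ (Literature.AlgebraicGeometry.Motives.IsSmoothProjective.tensor_holds hS hS') hS (CategoryTheory.SemiCartesianMonoidalCategory.fst S S') (rfl : 2 * 1 + 2 * 2 + 2 * 2 = 2 * 1 + 2 * (2 + 2)) (Literature.AlgebraicTopology.SingularHomology.cupProduct (rfl : 2 * 1 + 2 * 2 = 2 * 1 + 2 * 2) (Literature.AlgebraicGeometry.HodgeTheory.complexBetti.map (CategoryTheory.SemiCartesianMonoidalCategory.snd S S') (2 * 1) x) γ)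

/-- item stmt-HodgeConjecture-2751 · support · rank 9 · closed · moot by None · by planner
sources: Huybrechts2016K3, VanGeemenSarti2007, Morrison1984
[support] UNIVERSAL TWIN (period surjectivity + lattice theory): for every projective K3 S there is
a projective K3 S' and a rational (indeed integral) Hodge 2-similitude psi : H^2(S',Q) -> H^2(S,Q):
transport the completed Nikulin similitude Psi by markings and let S' be the K3 with period
Psi^{-1}(sigma_S) (Todorov/Looijenga-Peters surjectivity, Huybrechts2016K3 Ch. 7); S' is projective
because Psi^{-1} of an ample class has positive square (Huybrechts2016K3 Ch. 8); (S,S') ranges over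
a Hecke correspondence B between two 19-dimensional moduli spaces, dominant on both. Lattice input:
an integral 2-similitude of Lambda = U^3 + E_8(-1)^2 exists (U(2) in U, E_8(2) in E_8:
EEightTwoSimilitude). Also provides integral generators p, p' of H^4, which the target consumes.
LEAN: K3-like proxy (still true: H^2 of a proxy surface is unimodular of signature (3,19) with a
K3-type Hodge structure, so a K3 twin exists). Routine given the cited theorems, none of which is in
the tree (formalisation debt, not research risk). -/
@[route_item "route-HodgeConjecture-NikulinTwinSimilitude"]
def TwinExists : Prop :=
  ∀ (S : Literature.AlgebraicGeometry.Motives.SchemeOver ℂ), Literature.AlgebraicGeometry.Motives.IsSmoothProjective 2 S → (Subsingleton (Literature.AlgebraicGeometry.HodgeTheory.complexBetti S 1) ∧ Module.finrank ℂ (Literature.AlgebraicGeometry.HodgeTheory.complexBetti S (2 * 1)) = 22 ∧ Module.finrank ℂ (Submodule.span ℂ {c : Literature.AlgebraicGeometry.HodgeTheory.complexBetti S (2 * 1) | Literature.AlgebraicGeometry.HodgeTheory.IsOfHodgeType 2 S (2 * 1) 2 0 c}) = 1) → ∃ (S' : Literature.AlgebraicGeometry.Motives.SchemeOver ℂ)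 (p : Literature.AlgebraicGeometry.HodgeTheory.complexBetti S (2 * 2)) (p' : Literature.AlgebraicGeometry.HodgeTheory.complexBetti S' (2 * 2)) (ψ : Literature.AlgebraicGeometry.HodgeTheory.complexBetti S' (2 * 1) →ₗ[ℂ] Literature.AlgebraicGeometry.HodgeTheory.complexBetti S (2 * 1)), Literature.AlgebraicGeometry.Motives.IsSmoothProjective 2 S' ∧ (Subsingleton (Literature.AlgebraicGeometry.HodgeTheory.complexBetti S' 1) ∧ Module.finrank ℂ (Literature.AlgebraicGeometry.HodgeTheory.complexBetti S' (2 * 1)) = 22 ∧ Module.finrank ℂ (Submodule.span ℂ {c : Literature.AlgebraicGeometry.HodgeTheory.complexBetti S' (2 * 1) | Literature.AlgebraicGeometry.HodgeTheory.IsOfHodgeType 2 S' (2 * 1) 2 0 c}) = 1) ∧ (Literature.AlgebraicGeometry.HodgeTheory.IsIntegralClass p ∧ (∀ q : Literature.AlgebraicGeometry.HodgeTheory.complexBetti S (2 * 2), Literature.AlgebraicGeometry.HodgeTheory.IsIntegralClass q → ∃ n : ℤ, q = n • p)) ∧ (Literature.AlgebraicGeometry.HodgeTheory.IsIntegralClass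 p' ∧ (∀ q : Literature.AlgebraicGeometry.HodgeTheory.complexBetti S' (2 * 2), Literature.AlgebraicGeometry.HodgeTheory.IsIntegralClass q → ∃ n : ℤ, q = n • p')) ∧ (∀ x, Literature.AlgebraicGeometry.HodgeTheory.IsRationalClass x → Literature.AlgebraicGeometry.HodgeTheory.IsRationalClass (ψ x)) ∧ (∀ (i j : ℕ) x, Literature.AlgebraicGeometry.HodgeTheory.IsOfHodgeType 2 S' (2 * 1) i j x → Literature.AlgebraicGeometry.HodgeTheory.IsOfHodgeType 2 S (2 * 1) i j (ψ x)) ∧ (∀ (x y : Literature.AlgebraicGeometry.HodgeTheory.complexBetti S' (2 * 1)) (a : ℂ), Literature.AlgebraicTopology.SingularHomology.cupProduct (rfl : 2 * 1 + 2 * 1 = 2 * 2) x y = a • p' → Literature.AlgebraicTopology.SingularHomology.cupProduct (rfl : 2 * 1 + 2 * 1 = 2 * 2) (ψ x) (ψ y) = ((2 : ℂ) * a) • p)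

/-- item stmt-HodgeConjecture-2752 · support · rank 9 · closed · moot by None · by planner
sources: Varesco2023, VanGeemenSchuett2023, VanGeemen2008RM, Zarhin1983
[support] THE DELIVERABLE ONE STEP BEFORE HC(S x S): for every projective K3 S and every e in
End_Hdg(H^2(S,Q)) that is self-adjoint, kills NS(S) and satisfies e^2 = 2 on T(S) = NS^perp (real
multiplication by sqrt 2; VanGeemen2008RM; VanGeemenSchuett2023: maximal 8-dimensional families with
rho = 2 where the inducing cycle is unknown; Zarhin1983: totally real E acts self-adjointly), the
class of e in H^4(S x S,Q) is algebraic (e = [gamma]_*). GLUE, provable from TwinSimilitudeAlgebraic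
+ HodgeIsometryAlgebraic + TwinExists + Poincare duality (= Varesco2023 Thm 2.1 with the TWIN in
place of the Nikulin quotient): take the twin psi : H^2(S') -> H^2(S) (2-similitude, algebraic by
X); phi := (1/2) e o psi is rational, Hodge, kills NS(S') (psi maps NS' onto NS by Lefschetz (1,1),
e kills NS), maps T(S') into T(S) and is an isometry on T(S') ((phi x . phi y) = (1/4)(psi x . e^2
psi y) = (1/2)(psi x . psi y) = (x . y)), hence algebraic (Buskin, T-version); psi^t (transposed
class) is algebraic and psi o psi^t = 2 (non-degeneracy + b_2 = 22 on both sides), so e = phi o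
psi^t EXACTLY on H^2(S) (both sides vanish on NS(S)) — a composition of algebraic correspondences.
No Witt theorem, Hodge -/
@[route_item "route-HodgeConjecture-NikulinTwinSimilitude"]
def RealMultiplicationSqrtTwoAlgebraic : Prop :=
  ∀ (μ : Literature.AlgebraicGeometry.HodgeTheory.OrientationFamily), μ.HasPoincareDuality → ∀ (S : Literature.AlgebraicGeometry.Motives.SchemeOver ℂ) (hS : Literature.AlgebraicGeometry.Motives.IsSmoothProjective 2 S), (Subsingleton (Literature.AlgebraicGeometry.HodgeTheory.complexBetti S 1) ∧ Module.finrank ℂ (Literature.AlgebraicGeometry.HodgeTheory.complexBetti S (2 * 1)) = 22 ∧ Module.finrank ℂ (Submodule.span ℂ {c : Literature.AlgebraicGeometry.HodgeTheory.complexBetti S (2 * 1) | Literature.AlgebraicGeometry.HodgeTheory.IsOfHodgeType 2 S (2 * 1) 2 0 c}) = 1) → ∀ (e : Literature.AlgebraicGeometry.HodgeTheory.complexBetti S (2 * 1) →ₗ[ℂ] Literature.AlgebraicGeometry.HodgeTheory.complexBetti S (2 * 1)), (∀ x, Literature.AlgebraicGeometry.HodgeTheory.IsRationalClass x → Literature.AlgebraicGeometry.HodgeTheory.IsRationalClass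 (e x)) → (∀ (i j : ℕ) x, Literature.AlgebraicGeometry.HodgeTheory.IsOfHodgeType 2 S (2 * 1) i j x → Literature.AlgebraicGeometry.HodgeTheory.IsOfHodgeType 2 S (2 * 1) i j (e x)) → (∀ x y : Literature.AlgebraicGeometry.HodgeTheory.complexBetti S (2 * 1), Literature.AlgebraicTopology.SingularHomology.cupProduct (rfl : 2 * 1 + 2 * 1 = 2 * 2) (e x) y = Literature.AlgebraicTopology.SingularHomology.cupProduct (rfl : 2 * 1 + 2 * 1 = 2 * 2) x (e y)) → (∀ d ∈ Literature.AlgebraicGeometry.HodgeTheory.algebraicClasses S 1, e d = 0) → (∀ x : Literature.AlgebraicGeometry.HodgeTheory.complexBetti S (2 * 1), (∀ d ∈ Literature.AlgebraicGeometry.HodgeTheory.algebraicClasses S 1, Literature.AlgebraicTopology.SingularHomology.cupProduct (rfl : 2 * 1 + 2 * 1 = 2 * 2) x d = 0) → e (e x) = (2 : ℂ) • x) → ∃ γ ∈ Literature.AlgebraicGeometry.HodgeTheory.algebraicClasses (CategoryTheory.MonoidalCategoryStruct.tensorObj S S) 2, ∀ x : Literature.AlgebraicGeometry.HodgeTheory.complexBetti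 S (2 * 1), e x = Literature.AlgebraicGeometry.HodgeTheory.complexGysin μ (Literature.AlgebraicGeometry.Motives.IsSmoothProjective.tensor_holds hS hS) hS (CategoryTheory.SemiCartesianMonoidalCategory.fst S S) (rfl : 2 * 1 + 2 * 2 + 2 * 2 = 2 * 1 + 2 * (2 + 2)) (Literature.AlgebraicTopology.SingularHomology.cupProduct (rfl : 2 * 1 + 2 * 2 = 2 * 1 + 2 * 2) (Literature.AlgebraicGeometry.HodgeTheory.complexBetti.map (CategoryTheory.SemiCartesianMonoidalCategory.snd S S) (2 * 1) x) γ)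

/-- item stmt-HodgeConjecture-2753 · support · rank 9 · closed · moot by None · by planner
sources: Varesco2023, Zarhin1983, Deligne2000
[support] SUMMIT FRAGMENT = codomain of the Assembly: HodgeConjectureFor 4 (S x_C S) for every
projective K3(-like) surface S with End_Hdg(T(S)_Q) = Q + Q e, e^2 = 2 on T (real multiplication by
Q(sqrt 2) and nothing more; hypotheses spelled with the real carriers: e rational, Hodge,
self-adjoint, kills NS, e^2 = 2 on NS^perp, and every rational Hodge f killing NS with image in
NS^perp equals a + b e there). Bookkeeping from RealMultiplicationSqrtTwoAlgebraic (Varesco2023 p.8: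
'HC for X^2 <=> every element of End_Hdg(T(X)) is algebraic'): Hodge classes on S x S are H^0(x)H^4
+ H^4(x)H^0 (points x S), NS(x)NS (Lefschetz (1,1) twice), Hom_Hdg(T,NS) = 0 (T carries no rational
(1,1)-class), End_Hdg(T) = <id_T, e> with id_T = [Delta] - (NS and point parts) algebraic and e
algebraic; degrees 2 and 6 by Lefschetz (1,1) and duality; H^1 = H^3 = 0. Needs Kuenneth for
H^*((S(x)S)(C);C) and Hodge models of S(x)S (antecedent nonempty_hodgeModel of the Assembly):
in-tree formalisation debt, no research risk. With HodgeSimilitudeAlgebraic the same bookkeeping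
gives HC(S x S) for multiquadratic RM. Standalone this item is an open sub-case of HC (kind support:
it is the route's output, not a step) -/
@[route_item "route-HodgeConjecture-NikulinTwinSimilitude"]
def SquareHodgeOfSqrtTwo : Prop :=
  ∀ (S : Literature.AlgebraicGeometry.Motives.SchemeOver ℂ), Literature.AlgebraicGeometry.Motives.IsSmoothProjective 2 S → (Subsingleton (Literature.AlgebraicGeometry.HodgeTheory.complexBetti S 1) ∧ Module.finrank ℂ (Literature.AlgebraicGeometry.HodgeTheory.complexBetti S (2 * 1)) = 22 ∧ Module.finrank ℂ (Submodule.span ℂ {c : Literature.AlgebraicGeometry.HodgeTheory.complexBetti S (2 * 1) | Literature.AlgebraicGeometry.HodgeTheory.IsOfHodgeType 2 S (2 * 1) 2 0 c}) = 1) → ∀ (e : Literature.AlgebraicGeometry.HodgeTheory.complexBetti S (2 * 1) →ₗ[ℂ] Literature.AlgebraicGeometry.HodgeTheory.complexBetti S (2 * 1)), (∀ x, Literature.AlgebraicGeometry.HodgeTheory.IsRationalClass x → Literature.AlgebraicGeometry.HodgeTheory.IsRationalClass (e x)) → (∀ (i j : ℕ) x, Literature.AlgebraicGeometry.HodgeTheory.IsOfHodgeType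 2 S (2 * 1) i j x → Literature.AlgebraicGeometry.HodgeTheory.IsOfHodgeType 2 S (2 * 1) i j (e x)) → (∀ x y : Literature.AlgebraicGeometry.HodgeTheory.complexBetti S (2 * 1), Literature.AlgebraicTopology.SingularHomology.cupProduct (rfl : 2 * 1 + 2 * 1 = 2 * 2) (e x) y = Literature.AlgebraicTopology.SingularHomology.cupProduct (rfl : 2 * 1 + 2 * 1 = 2 * 2) x (e y)) → (∀ d ∈ Literature.AlgebraicGeometry.HodgeTheory.algebraicClasses S 1, e d = 0) → (∀ x : Literature.AlgebraicGeometry.HodgeTheory.complexBetti S (2 * 1), (∀ d ∈ Literature.AlgebraicGeometry.HodgeTheory.algebraicClasses S 1, Literature.AlgebraicTopology.SingularHomology.cupProduct (rfl : 2 * 1 + 2 * 1 = 2 * 2) x d = 0) → e (e x) = (2 : ℂ) • x) → (∀ (f : Literature.AlgebraicGeometry.HodgeTheory.complexBetti S (2 * 1) →ₗ[ℂ] Literature.AlgebraicGeometry.HodgeTheory.complexBetti S (2 * 1)), (∀ x, Literature.AlgebraicGeometry.HodgeTheory.IsRationalClass x → Literature.AlgebraicGeometry.HodgeTheory.IsRationalClass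 (f x)) → (∀ (i j : ℕ) x, Literature.AlgebraicGeometry.HodgeTheory.IsOfHodgeType 2 S (2 * 1) i j x → Literature.AlgebraicGeometry.HodgeTheory.IsOfHodgeType 2 S (2 * 1) i j (f x)) → (∀ d ∈ Literature.AlgebraicGeometry.HodgeTheory.algebraicClasses S 1, f d = 0) → (∀ x : Literature.AlgebraicGeometry.HodgeTheory.complexBetti S (2 * 1), ∀ d ∈ Literature.AlgebraicGeometry.HodgeTheory.algebraicClasses S 1, Literature.AlgebraicTopology.SingularHomology.cupProduct (rfl : 2 * 1 + 2 * 1 = 2 * 2) (f x) d = 0) → ∃ a b : ℚ, ∀ x : Literature.AlgebraicGeometry.HodgeTheory.complexBetti S (2 * 1), (∀ d ∈ Literature.AlgebraicGeometry.HodgeTheory.algebraicClasses S 1, Literature.AlgebraicTopology.SingularHomology.cupProduct (rfl : 2 * 1 + 2 * 1 = 2 * 2) x d = 0) → f x = (a : ℂ) • x + (b : ℂ) • e x) → Literature.AlgebraicGeometry.HodgeTheory.HodgeConjectureFor 4 (CategoryTheory.MonoidalCategoryStruct.tensorObj S S)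

/-- item stmt-HodgeConjecture-2754 · support · rank 9 · closed · moot by None · by planner
sources: Varesco2023
[support] Linear algebra of the twin factorisation (Varesco2023 Thm 2.1 / Rem. 2.2 in abstract
form), provable now in Mathlib: for bilinear forms B on V and C on W, a 2-similitude psi : W -> V, a
map chi : V -> W adjoint to it (C(chi x, y) = B(x, psi y)) with psi o chi = 2, and a B-self-adjoint
e with e^2 = 2: phi := (1/2) e o psi is an isometry (W,C) -> (V,B) and e = phi o chi. In the route V
= T(S)_Q, W = T(S')_Q, psi = twin similitude, chi = psi^t, e = sqrt 2. Documentation/sanity item;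
closes with ext/simp/ring-level reasoning. -/
@[route_item "route-HodgeConjecture-NikulinTwinSimilitude"]
def TwinFactorisation : Prop :=
  ∀ (V W : Type) [AddCommGroup V] [Module ℚ V] [AddCommGroup W] [Module ℚ W] (B : LinearMap.BilinForm ℚ V) (C : LinearMap.BilinForm ℚ W) (ψ : W →ₗ[ℚ] V) (χ : V →ₗ[ℚ] W) (e : V →ₗ[ℚ] V), (∀ x y, B (ψ x) (ψ y) = 2 * C x y) → (∀ x y, C (χ x) y = B x (ψ y)) → (∀ x y, B (e x) y = B x (e y)) → (∀ x, e (e x) = (2 : ℚ) • x) → (∀ x, ψ (χ x) = (2 : ℚ) • x) → (∀ x y, B (((1 / 2 : ℚ) • (e ∘ₗ ψ)) x) (((1 / 2 : ℚ) • (e ∘ₗ ψ)) y) = C x y) ∧ e = ((1 / 2 : ℚ) • (e ∘ₗ ψ)) ∘ₗ χ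

/-- item stmt-HodgeConjecture-2755 · support · rank 9 · closed · moot by None · by planner
sources: VanGeemenSarti2007, Morrison1984, Huybrechts2016K3
[support] Lattice core of the completed Nikulin similitude and of TwinExists (card: fastest
refutation (iii)), decidable with Mathlib's CartanMatrix.E_8: (1) E_8 contains eight pairwise
orthogonal roots (an A_1^8 subsystem, e.g. +-e_1+-e_2, ...) whose sum is 2-divisible in E_8 — so
E_8(-2) in NS(X) contains eight pairwise orthogonal (-4)-vectors r_j with (1/2) sum r_j in E_8(-2),
matching the even eight delta = (1/2) sum N_j (VanGeemenSarti2007 Sec. 1, Morrison1984 Sec. 5):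
Psi(N_j) = r_j and Psi(delta) = (1/2) sum r_j is integral; (2) E_8(2) embeds in E_8 (a 4-dimensional
totally singular subspace of E_8/2E_8 = O_8^+(2)), which with U(2) in U yields an integral
2-similitude of the K3 lattice U^3 + E_8(-1)^2. Expected proof: exhibit R, w, M explicitly and
`decide` / `norm_num [Matrix.mul_apply]`. -/
@[route_item "route-HodgeConjecture-NikulinTwinSimilitude"]
def EEightTwoSimilitude : Prop :=
  (∃ R : Matrix (Fin 8) (Fin 8) ℤ, R.transpose * CartanMatrix.E₈ * R = 2 • (1 : Matrix (Fin 8) (Fin 8) ℤ) ∧ ∃ w : Fin 8 → ℤ, R.mulVec (fun _ => 1) = 2 • w) ∧ ∃ M : Matrix (Fin 8) (Fin 8) ℤ, M.transpose * CartanMatrix.E₈ * M = 2 • CartanMatrix.E₈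

/-- item stmt-HodgeConjecture-2756 · assembly · rank 1 · closed · moot by None · by planner
sources: Varesco2023, Buskin2019
[assembly] (Hodge models exist: nonempty_hodgeModel, a theorem) -> (an orientation family with
Poincare duality exists: bijective_poincareDualityMap, a theorem) -> X -> Buskin -> twin exists ->
Lefschetz (1,1) -> SquareHodgeOfSqrtTwo, i.e. HC in degree 4 for S x S for every projective
K3(-like) S with End_Hdg(T(S)_Q) = Q(sqrt 2). Proof plan: the glue of
RealMultiplicationSqrtTwoAlgebraic (phi := (1/2) e o psi is a T-isometry, e = phi o psi^t; lemmas
wanted via --supports Assembly: composition and transpose of algebraic correspondences are algebraic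
with [g2]_* o [g1]_* = [g2 o g1]_* and [g^t]_* = ([g]_*)^dagger — projection formula
complexGysin_cup + Gysin base change for S x S' x S'') followed by SquareHodgeOfSqrtTwo's Kuenneth
bookkeeping. The statement names the sibling decls (each piece < 4000 chars). Two-layer plan
(D-0019): below X, NikulinSerreCarrier -> TwinTwistorTransport -> GAGA endpoint -> X is informal
until IsK3Surface / Kaehler classes / slope-polystability / analytic Chern classes land in
Literature (definition requests filed); no further decomposition until a crux closes. -/
@[route_item "route-HodgeConjecture-NikulinTwinSimilitude"]
def Assembly : Prop :=
  (∀ (n : ℕ) (X : Literature.AlgebraicGeometry.Motives.SchemeOver ℂ), Literature.AlgebraicGeometry.HodgeTheory.nonempty_hodgeModel n X) → (∃ μ : Literature.AlgebraicGeometry.HodgeTheory.OrientationFamily, μ.HasPoincareDuality) → TwinSimilitudeAlgebraic → HodgeIsometryAlgebraic → TwinExists → Literature.AlgebraicGeometry.HodgeTheory.lefschetzOneOne_rational → SquareHodgeOfSqrtTwo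

end Summit.HodgeConjecture.HodgeConjecture.Theses.NikulinTwinSimilitude
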